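import Literature.NumberTheory.GaloisRepresentations.LubinTateUnramifiedDisjoint
import HarnessLib

/-!
# `Gal(E·K_π^{m+1}/E)` for an unramified base `E`: restriction from `Γ_F`, the automorphisms `σ_v`, and the
# parametrisation of the stabiliser of `[π^k]ω` (de Shalit I §1.8, §2.2 (2), relative situation)

De Shalit, *Iwasawa theory of elliptic curves with complex multiplication* (1987), Ch. I §1.8: for an unramified
base `k' ⊇ k` and a relative Lubin–Tate group, `k'(W_f^{n})/k'` is totally ramified with group `(𝒪/𝔭^n)^×`,
`u ↦ σ_u`.  Here `k' = E ⊆ F^{nr} = maxUnramified F` is finite and normal over `F`, the formal group is that of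
`f = πX + X^q` of `F` (so `k'(W_f^{m+1}) = E·K_π^{m+1} = E ⊔ ltField π m` inside `F̄`), and the base point is
`λ' = ι(λ_{m+1})` (`relGenPt`), acted on by `[a]_f` (`relAct`).  Everything PROVED (0 sorry, no named facts),
from the tree's `LubinTateUnramifiedDisjoint` (`ltAbsChar` is onto on `Gal(F̄/E)`; Galois form of
`E ∩ K_π^{m+1} = F`):

* `relRestrict σ̃` — restriction of `σ̃ ∈ Γ_F` to the normal extension `E·K_π^{m+1}`; `coe_relRestrict_apply`;
  `relRestrict_surjective`; ★ `mapPt_relRestrict_relAct` — **`σ̃([a]λ') = [χ_π(σ̃)·a]λ'`** (`lubinTateChar`).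
* `relAct_relGenPt_eq_iff` — `[a]λ' = [b]λ' ↔ π^{m+1} ∣ a − b`.
* ★ `algHom_apply_inclusion_eq_of_eq` — **an `F`-algebra map out of `E·K_π^{m+1}` is determined on `E·K_π^{n+1}`
  (`n ≤ m`) by its values on `E` and on `λ_{n+1}`**; hence `algEquiv_eq_of_forall_apply_inclusion_eq`
  (automorphisms fixing `E` are determined by `σ λ'`) and ★ `forall_apply_inclusion_sup_iff` (**`σ` fixes
  `E·K_π^{n+1}` pointwise iff it fixes `E` pointwise and fixes `ι(λ_{n+1})`** — the stabiliser form of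
  `Gal(E·K_π^{m+1}/E·K_π^{n+1})` used for relative norms).
* `relGalOfUnit v` (`E ⊆ F^{nr}`) — **the `σ_v ∈ Gal(E·K_π^{m+1}/E)` with `σ_v λ' = [v]λ'`**:
  `relGalOfUnit_apply_inclusion` (fixes `E`), ★ `mapPt_relGalOfUnit_relAct` (`σ_v [a]λ' = [v a]λ'`);
  `exists_unit_mapPt_eq_relAct` (every `σ` acts on `λ'` through a unit).
* The stabiliser of `[π^k]ω`, `ω = [u]λ'`, in `Gal(E·K_π^{m+1}/E)` (de Shalit's (2)): `relStabParam e`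
  (`e ∈ 𝓀^k ↦ σ_e`, `σ_e ω = [u + π^{m+1-k} Σ digit(eᵢ)πⁱ]λ'`), `relStabParam_apply_inclusion`,
  `mapPt_relStabParam`, `mapPt_relStabParam_pow` (fixes `[π^k]ω`), `relStabParam_injective`,
  ★ `exists_relStabParam_eq` (exhausts `{σ : σ|_E = id, σ[π^k]ω = [π^k]ω}`).

Sequel: `LubinTateColemanRelativeNormCoherentTwo` (the product over this stabiliser of `σ(G^ι(ω))` is
`(𝒩_E^{(k)}G)^ι([π^k]ω)`, de Shalit I §2.2 (2) over `𝒪_E`).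

## References

* E. de Shalit, *Iwasawa theory of elliptic curves with complex multiplication* (1987), Ch. I §1.8, §2.2 (2). [deShalit1987]
* J.-P. Serre, *Local class field theory*, Ch. VI of Cassels–Fröhlich (1967), §3.6 Prop. 6 (b). [CasselsFrohlichANT1967]

## Mathlib / tree reuse

`IntermediateField.normal_sup`, `AlgEquiv.restrictNormalHom(_surjective)`, `AlgEquiv.restrictNormal_commutes`,
`IntermediateField.restrictScalars_adjoin_eq_sup`, `IntermediateField.adjoin_induction`; tree: `isGalois_ltField`,
`exists_absGal_fixing_smul_ltRoot_eq`, `absGal_smul_ltAct_lubinTateChar`, `inclUnitBall_ltSMul`, `ltAct_genPt_eq_iff`,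
`exists_digits`, `digits_injective`, `isUnit_add_pow_mul`, `pt_ext`.
-/

noncomputable section

namespace Literature.NumberTheory.GaloisRepresentations

section UnramifiedRelativeGalois

open GaloisRepresentations.IsNonarchimedeanLocalField LubinTate ValuativeRel Field

variable (F : Type*) [Field F] [ValuativeRel F] [TopologicalSpace F] [IsNonarchimedeanLocalField F]

attribute [local instance] ltNormUniformSpace ltNormIsUniformAddGroup rk1 nF nE fintypeResidueField

variable {F}
variable {π : 𝒪[F]} (hπ : (valuation F).IsUniformizer (π : F))
variable (E : IntermediateField F (AlgebraicClosure F)) [FiniteDimensional F E] (m : ℕ)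

/-! ### The base point `λ' = ι(λ_{m+1})` of `E·K_π^{m+1}` and the action `[a]_f` -/

/-- **`λ' = λ_{m+1}` read in `E·K_π^{m+1} = E ⊔ K_π^{m+1}`** (a point of its maximal ideal).
[cite: deShalit1987, Ch. I §1.8] -/
abbrev relGenPt : (maxNilIdeal F (E ⊔ ltField π m : IntermediateField F (AlgebraicClosure F))).toIdeal :=
  inclPt le_sup_right (genPt hπ m)

/-- **`[a]_f x`** for a point `x` of `𝔪_{E·K_π^{m+1}}` (the accepted `ltSMul` with coefficients in `LTCoeff F`).
[cite: CasselsFrohlichANT1967, Ch. VI §3.4] -/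
abbrev relAct (a : 𝒪[F])
    (x : (maxNilIdeal F (E ⊔ ltField π m : IntermediateField F (AlgebraicClosure F))).toIdeal) :
    (maxNilIdeal F (E ⊔ ltField π m : IntermediateField F (AlgebraicClosure F))).toIdeal :=
  ltSMul (maxNilIdeal F (E ⊔ ltField π m : IntermediateField F (AlgebraicClosure F))) (isLTRing_LTCoeff hπ)
    (isLTSeries_LTCoeff π) (LTCoeff.of F a) x

/-- `[1] x = x`. [cite: LubinTate1965, §1 Thm. 1 (11)] -/
theorem relAct_one (x : (maxNilIdeal F (E ⊔ ltField π m : IntermediateField F (AlgebraicClosure F))).toIdeal) :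
    relAct hπ E m 1 x = x := by
  rw [relAct, map_one]; exact one_ltSMul _ _ _ x

/-- `[a b] x = [a]([b] x)`. [cite: LubinTate1965, §1 Thm. 1 (9)] -/
theorem relAct_mul (a b : 𝒪[F])
    (x : (maxNilIdeal F (E ⊔ ltField π m : IntermediateField F (AlgebraicClosure F))).toIdeal) :
    relAct hπ E m (a * b) x = relAct hπ E m a (relAct hπ E m b x) := by
  rw [relAct, map_mul]; exact mul_ltSMul _ _ _ _ _ x

/-- **`σ([a] x) = [a](σ x)`**: automorphisms commute with `[a]_f` (coefficients in `𝒪_F`).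
[cite: CasselsFrohlichANT1967, Ch. VI §3.4] -/
theorem mapPt_relAct' (σ : (E ⊔ ltField π m : IntermediateField F (AlgebraicClosure F)) ≃ₐ[F]
      (E ⊔ ltField π m : IntermediateField F (AlgebraicClosure F))) (a : 𝒪[F])
    (x : (maxNilIdeal F (E ⊔ ltField π m : IntermediateField F (AlgebraicClosure F))).toIdeal) :
    mapPt σ (relAct hπ E m a x) = relAct hπ E m a (mapPt σ x) :=
  mapPt_ltSMul σ (LTCoeff.of F a) x

/-- `ι([a] λ_{m+1}) = [a] λ'`. [cite: CasselsFrohlichANT1967, Ch. VI §3.4] -/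
theorem inclPt_ltAct_genPt (a : 𝒪[F]) :
    inclPt (le_sup_right : ltField π m ≤ E ⊔ ltField π m) (ltAct hπ m a (genPt hπ m)) =
      relAct hπ E m a (relGenPt hπ E m) :=
  Subtype.ext (inclUnitBall_ltSMul _ (LTCoeff.of F a) (genPt hπ m))

/-- `[a]λ'` read in `F̄` is `[a]λ_{m+1}`. [cite: CasselsFrohlichANT1967, Ch. VI §3.4] -/
theorem coe_relAct_relGenPt (a : 𝒪[F]) :
    ((((relAct hπ E m a (relGenPt hπ E m) :
        (maxNilIdeal F (E ⊔ ltField π m : IntermediateField F (AlgebraicClosure F))).toIdeal) :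
        unitBall (E ⊔ ltField π m : IntermediateField F (AlgebraicClosure F))) :
        (E ⊔ ltField π m : IntermediateField F (AlgebraicClosure F))) : AlgebraicClosure F) =
      (((ltAct hπ m a (genPt hπ m) : unitBall (ltField π m)) : ltField π m) : AlgebraicClosure F) := by
  rw [← inclPt_ltAct_genPt, coe_inclPt]

/-- ★ **`[a]λ' = [b]λ' ↔ π^{m+1} ∣ a − b`** (`λ'` is a primitive `π^{m+1}`-division point).
[cite: CasselsFrohlichANT1967, Ch. VI §3.6 Prop. 6 (a)] -/
theorem relAct_relGenPt_eq_iff {a b : 𝒪[F]} :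
    relAct hπ E m a (relGenPt hπ E m) = relAct hπ E m b (relGenPt hπ E m) ↔ π ^ (m + 1) ∣ a - b := by
  rw [← ltAct_genPt_eq_iff hπ, ← inclPt_ltAct_genPt, ← inclPt_ltAct_genPt]
  constructor
  · intro h
    exact pt_ext (by rw [← coe_inclPt (le_sup_right : ltField π m ≤ E ⊔ ltField π m), h, coe_inclPt])
  · intro h; rw [h]

/-! ### Restriction from `Γ_F` to the normal extension `E·K_π^{m+1}` -/

omit [FiniteDimensional F E] in
include hπ in
/-- `E·K_π^{m+1}` is normal over `F` for `E` normal. [cite: deShalit1987, Ch. I §1.8] -/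
theorem normal_sup_ltField [Normal F E] : Normal F (E ⊔ ltField π m : IntermediateField F (AlgebraicClosure F)) := by
  haveI := isGalois_ltField hπ m
  infer_instance

omit [FiniteDimensional F E] in
include hπ in
/-- `E·K_π^{m+1}` is Galois over `F` for `E` Galois. [cite: deShalit1987, Ch. I §1.8] -/
theorem isGalois_sup_ltField [IsGalois F E] : IsGalois F (E ⊔ ltField π m : IntermediateField F (AlgebraicClosure F)) := by
  haveI := isGalois_ltField hπ m
  exact ⟨⟩

include hπ in
/-- **The restriction of `σ̃ ∈ Γ_F` to `E·K_π^{m+1}`.** [cite: deShalit1987, Ch. I §1.8] -/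
def relRestrict [Normal F E] (σ : absoluteGaloisGroup F) :
    (E ⊔ ltField π m : IntermediateField F (AlgebraicClosure F)) ≃ₐ[F]
      (E ⊔ ltField π m : IntermediateField F (AlgebraicClosure F)) :=
  haveI := normal_sup_ltField hπ E m
  AlgEquiv.restrictNormalHom (F := F) (K₁ := AlgebraicClosure F)
    (E ⊔ ltField π m : IntermediateField F (AlgebraicClosure F)) (absoluteGaloisGroup.toAlgEquiv F σ)

omit [FiniteDimensional F E] in
/-- `relRestrict σ̃` acts as `σ̃`. [cite: deShalit1987, Ch. I §1.8] -/
theorem coe_relRestrict_apply [Normal F E] (σ : absoluteGaloisGroup F)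
    (z : (E ⊔ ltField π m : IntermediateField F (AlgebraicClosure F))) :
    ((relRestrict hπ E m σ z : (E ⊔ ltField π m : IntermediateField F (AlgebraicClosure F))) :
      AlgebraicClosure F) = σ • (z : AlgebraicClosure F) := by
  haveI := normal_sup_ltField hπ E m
  rw [absoluteGaloisGroup.smul_def]
  exact AlgEquiv.restrictNormalHom_apply _ _ z

omit [FiniteDimensional F E] in
/-- `relRestrict` is multiplicative. [cite: deShalit1987, Ch. I §1.8] -/
theorem relRestrict_mul [Normal F E] (σ τ : absoluteGaloisGroup F) :
    relRestrict hπ E m (σ * τ) = relRestrict hπ E m σ * relRestrict hπ E m τ := by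
  haveI := normal_sup_ltField hπ E m
  unfold relRestrict
  rw [map_mul, map_mul]

omit [FiniteDimensional F E] in
/-- **Every `F`-automorphism of `E·K_π^{m+1}` is a restriction from `Γ_F`.** [cite: deShalit1987, Ch. I §1.8] -/
theorem relRestrict_surjective [Normal F E] : Function.Surjective (relRestrict hπ E m) := by
  haveI := normal_sup_ltField hπ E m
  intro τ
  obtain ⟨σ, hσ⟩ := AlgEquiv.restrictNormalHom_surjective (F := F) (E := AlgebraicClosure F)
    (K₁ := (E ⊔ ltField π m : IntermediateField F (AlgebraicClosure F))) τ
  exact ⟨(absoluteGaloisGroup.toAlgEquiv F).symm σ, by rw [relRestrict, MulEquiv.apply_symm_apply]; exact hσ⟩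

/-- ★ **`σ̃([a]λ') = [χ_π(σ̃) · a]λ'`**: `Γ_F` acts on the division points through the Lubin–Tate character.
[cite: CasselsFrohlichANT1967, Ch. VI §3.4 Thm. 3 (b)] -/
theorem mapPt_relRestrict_relAct [Normal F E] (σ : absoluteGaloisGroup F) (a : 𝒪[F]) :
    mapPt (relRestrict hπ E m σ) (relAct hπ E m a (relGenPt hπ E m)) =
      relAct hπ E m ((lubinTateChar hπ σ : 𝒪[F]) * a) (relGenPt hπ E m) := by
  refine pt_ext ?_
  rw [coe_mapPt, coe_relRestrict_apply, coe_relAct_relGenPt, coe_relAct_relGenPt, absGal_smul_ltAct_lubinTateChar]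

omit [FiniteDimensional F E] in
/-- `relRestrict σ̃` fixes `E` pointwise when `σ̃` does. [cite: deShalit1987, Ch. I §1.8] -/
theorem relRestrict_apply_inclusion [Normal F E] {σ : absoluteGaloisGroup F}
    (hσ : ∀ x : E, σ • (x : AlgebraicClosure F) = x) (x : E) :
    relRestrict hπ E m σ (IntermediateField.inclusion le_sup_left x) = IntermediateField.inclusion le_sup_left x :=
  Subtype.ext (by rw [coe_relRestrict_apply, IntermediateField.coe_inclusion, hσ x])

/-! ### Automorphisms are determined by their values on `E` and on `λ_{n+1}` -/

omit [FiniteDimensional F E] in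
/-- `λ_{n+1}` read in `F̄` is the chosen root `ltRoot π n`. [cite: CasselsFrohlichANT1967, Ch. VI §3.6] -/
theorem coe_genPt_eq_ltRoot (n : ℕ) :
    ((((genPt hπ n : (maxNilIdeal F (ltField π n)).toIdeal) : unitBall (ltField π n)) : ltField π n) :
      AlgebraicClosure F) = ltRoot π n :=
  IntermediateField.AdjoinSimple.coe_gen F (ltRoot π n)

/-- `λ'` read in `F̄` is `ltRoot π m`. [cite: CasselsFrohlichANT1967, Ch. VI §3.6] -/
theorem coe_relGenPt_eq_ltRoot :
    ((((relGenPt hπ E m :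
        (maxNilIdeal F (E ⊔ ltField π m : IntermediateField F (AlgebraicClosure F))).toIdeal) :
        unitBall (E ⊔ ltField π m : IntermediateField F (AlgebraicClosure F))) :
        (E ⊔ ltField π m : IntermediateField F (AlgebraicClosure F))) : AlgebraicClosure F) = ltRoot π m :=
  (coe_inclPt _ _).trans (coe_genPt_eq_ltRoot hπ m)

omit [FiniteDimensional F E] in
include hπ in
/-- ★ **Two `F`-automorphisms of `E·K_π^{m+1}` that agree on `E` and on `λ_{n+1}` (`n ≤ m`) agree on
`E·K_π^{n+1}`** (`E·K_π^{n+1}` is generated over `F` by `E` and `λ_{n+1}`: induction over `E(λ_{n+1})`).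
[cite: deShalit1987, Ch. I §1.8] -/
theorem algEquiv_apply_mk_eq_of_eq {n : ℕ} (hnm : n ≤ m)
    (σ τ : (E ⊔ ltField π m : IntermediateField F (AlgebraicClosure F)) ≃ₐ[F]
      (E ⊔ ltField π m : IntermediateField F (AlgebraicClosure F)))
    (hE : ∀ x : E, σ (IntermediateField.inclusion le_sup_left x) = τ (IntermediateField.inclusion le_sup_left x))
    (hgen : ∀ h : ltRoot π n ∈ (E ⊔ ltField π m : IntermediateField F (AlgebraicClosure F)),
      σ ⟨ltRoot π n, h⟩ = τ ⟨ltRoot π n, h⟩)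
    {z : AlgebraicClosure F} (hz : z ∈ (E ⊔ ltField π n : IntermediateField F (AlgebraicClosure F)))
    (hz' : z ∈ (E ⊔ ltField π m : IntermediateField F (AlgebraicClosure F))) :
    σ ⟨z, hz'⟩ = τ ⟨z, hz'⟩ := by
  have hle : E ⊔ ltField π n ≤ E ⊔ ltField π m := sup_le_sup_left (ltField_mono hπ hnm) E
  have hy : z ∈ IntermediateField.adjoin E ({ltRoot π n} : Set (AlgebraicClosure F)) := by
    have h1 : z ∈ IntermediateField.restrictScalars F (IntermediateField.adjoin E {ltRoot π n}) := by
      rw [IntermediateField.restrictScalars_adjoin_eq_sup]; exact hz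
    exact (IntermediateField.mem_restrictScalars F).mp h1
  have hmem : ∀ {w : AlgebraicClosure F}, w ∈ IntermediateField.adjoin E ({ltRoot π n} : Set (AlgebraicClosure F)) →
      w ∈ (E ⊔ ltField π m : IntermediateField F (AlgebraicClosure F)) := by
    intro w hw
    have h1 : w ∈ IntermediateField.restrictScalars F (IntermediateField.adjoin E {ltRoot π n}) :=
      (IntermediateField.mem_restrictScalars F).mpr hw
    rw [IntermediateField.restrictScalars_adjoin_eq_sup] at h1
    exact hle h1
  revert hz'
  refine IntermediateField.adjoin_induction (F := E) (s := ({ltRoot π n} : Set (AlgebraicClosure F)))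
    (p := fun w _ => ∀ hw' : w ∈ (E ⊔ ltField π m : IntermediateField F (AlgebraicClosure F)), σ ⟨w, hw'⟩ = τ ⟨w, hw'⟩)
    ?_ ?_ ?_ ?_ ?_ hy
  · intro w hw hw'
    rw [Set.mem_singleton_iff] at hw
    subst hw
    exact hgen hw'
  · intro x _
    exact hE x
  · intro a b ha hb iha ihb hab
    have e : (⟨a + b, hab⟩ : (E ⊔ ltField π m : IntermediateField F (AlgebraicClosure F))) =
        ⟨a, hmem ha⟩ + ⟨b, hmem hb⟩ := rfl
    rw [e, map_add, map_add, iha (hmem ha), ihb (hmem hb)]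
  · intro a ha iha ha'
    have e : (⟨a⁻¹, ha'⟩ : (E ⊔ ltField π m : IntermediateField F (AlgebraicClosure F))) = (⟨a, hmem ha⟩)⁻¹ := rfl
    rw [e, map_inv₀, map_inv₀, iha (hmem ha)]
  · intro a b ha hb iha ihb hab
    have e : (⟨a * b, hab⟩ : (E ⊔ ltField π m : IntermediateField F (AlgebraicClosure F))) =
        ⟨a, hmem ha⟩ * ⟨b, hmem hb⟩ := rfl
    rw [e, map_mul, map_mul, iha (hmem ha), ihb (hmem hb)]

/-- ★ **`σ ∈ Aut(E·K_π^{m+1}/F)` fixes `E·K_π^{n+1}` pointwise iff it fixes `E` pointwise and fixes `ι(λ_{n+1})`**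
(`n ≤ m`): the stabiliser description of `Gal(E·K_π^{m+1}/E·K_π^{n+1})`. [cite: deShalit1987, Ch. I §1.8, §2.2] -/
theorem forall_apply_inclusion_sup_iff {n : ℕ} (hnm : n ≤ m)
    (σ : (E ⊔ ltField π m : IntermediateField F (AlgebraicClosure F)) ≃ₐ[F]
      (E ⊔ ltField π m : IntermediateField F (AlgebraicClosure F))) :
    (∀ y : (E ⊔ ltField π n : IntermediateField F (AlgebraicClosure F)),
        σ (IntermediateField.inclusion (sup_le_sup_left (ltField_mono hπ hnm) E) y) =
          IntermediateField.inclusion (sup_le_sup_left (ltField_mono hπ hnm) E) y) ↔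
      (∀ x : E, σ (IntermediateField.inclusion le_sup_left x) = IntermediateField.inclusion le_sup_left x) ∧
        mapPt σ (inclPt (sup_le_sup_left (ltField_mono hπ hnm) E) (relGenPt hπ E n)) =
          inclPt (sup_le_sup_left (ltField_mono hπ hnm) E) (relGenPt hπ E n) := by
  have hle : E ⊔ ltField π n ≤ E ⊔ ltField π m := sup_le_sup_left (ltField_mono hπ hnm) E
  constructor
  · intro h
    refine ⟨fun x => h (IntermediateField.inclusion le_sup_left x), ?_⟩
    apply Subtype.ext; apply Subtype.ext
    rw [coe_mapPt]
    exact h _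
  · rintro ⟨hE, hgen⟩ ⟨z, hz⟩
    have hgen' := congrArg (fun w : (maxNilIdeal F (E ⊔ ltField π m : IntermediateField F (AlgebraicClosure F))).toIdeal =>
      ((w : unitBall (E ⊔ ltField π m : IntermediateField F (AlgebraicClosure F))) :
        (E ⊔ ltField π m : IntermediateField F (AlgebraicClosure F)))) hgen
    simp only [coe_mapPt] at hgen'
    have key := algEquiv_apply_mk_eq_of_eq hπ E m hnm σ 1 (fun x => by rw [AlgEquiv.one_apply, hE])
      (fun h => by
        have e : (⟨ltRoot π n, h⟩ : (E ⊔ ltField π m : IntermediateField F (AlgebraicClosure F))) =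
            ((inclPt hle (relGenPt hπ E n) :
              (maxNilIdeal F (E ⊔ ltField π m : IntermediateField F (AlgebraicClosure F))).toIdeal) :
              unitBall (E ⊔ ltField π m : IntermediateField F (AlgebraicClosure F))) :=
          Subtype.ext (by rw [coe_inclPt, coe_relGenPt_eq_ltRoot])
        rw [e, AlgEquiv.one_apply]; exact hgen') hz (hle hz)
    rw [AlgEquiv.one_apply] at key
    exact key

/-- ★ **An automorphism of `E·K_π^{m+1}` fixing `E` pointwise is determined by its value on `λ'`.**
[cite: CasselsFrohlichANT1967, Ch. VI §3.6 Prop. 6 (b)] -/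
theorem algEquiv_eq_of_forall_apply_inclusion_eq
    {σ τ : (E ⊔ ltField π m : IntermediateField F (AlgebraicClosure F)) ≃ₐ[F]
      (E ⊔ ltField π m : IntermediateField F (AlgebraicClosure F))}
    (hσ : ∀ x : E, σ (IntermediateField.inclusion le_sup_left x) = IntermediateField.inclusion le_sup_left x)
    (hτ : ∀ x : E, τ (IntermediateField.inclusion le_sup_left x) = IntermediateField.inclusion le_sup_left x)
    (h : mapPt σ (relGenPt hπ E m) = mapPt τ (relGenPt hπ E m)) : σ = τ := by
  have h' := congrArg (fun z : (maxNilIdeal F (E ⊔ ltField π m : IntermediateField F (AlgebraicClosure F))).toIdeal =>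
    ((z : unitBall (E ⊔ ltField π m : IntermediateField F (AlgebraicClosure F))) :
      (E ⊔ ltField π m : IntermediateField F (AlgebraicClosure F)))) h
  simp only [coe_mapPt] at h'
  refine AlgEquiv.ext fun y => ?_
  obtain ⟨z, hz⟩ := y
  refine algEquiv_apply_mk_eq_of_eq hπ E m le_rfl σ τ (fun x => by rw [hσ, hτ]) (fun hr => ?_) hz hz
  have e : (⟨ltRoot π m, hr⟩ : (E ⊔ ltField π m : IntermediateField F (AlgebraicClosure F))) =
      ((relGenPt hπ E m : (maxNilIdeal F (E ⊔ ltField π m : IntermediateField F (AlgebraicClosure F))).toIdeal) :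
        unitBall (E ⊔ ltField π m : IntermediateField F (AlgebraicClosure F))) :=
    Subtype.ext (by rw [coe_relGenPt_eq_ltRoot])
  rw [e]
  exact h'

/-- An automorphism fixing `E` pointwise is determined by its value on any primitive point `[u]λ'`.
[cite: CasselsFrohlichANT1967, Ch. VI §3.6 Prop. 6 (b)] -/
theorem algEquiv_eq_of_mapPt_relAct_eq (u : 𝒪[F]ˣ)
    {σ τ : (E ⊔ ltField π m : IntermediateField F (AlgebraicClosure F)) ≃ₐ[F]
      (E ⊔ ltField π m : IntermediateField F (AlgebraicClosure F))}
    (hσ : ∀ x : E, σ (IntermediateField.inclusion le_sup_left x) = IntermediateField.inclusion le_sup_left x)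
    (hτ : ∀ x : E, τ (IntermediateField.inclusion le_sup_left x) = IntermediateField.inclusion le_sup_left x)
    (h : mapPt σ (relAct hπ E m (u : 𝒪[F]) (relGenPt hπ E m)) = mapPt τ (relAct hπ E m (u : 𝒪[F]) (relGenPt hπ E m))) :
    σ = τ := by
  refine algEquiv_eq_of_forall_apply_inclusion_eq hπ E m hσ hτ ?_
  have h1 := congrArg (relAct hπ E m ((u⁻¹ : 𝒪[F]ˣ) : 𝒪[F])) h
  rwa [← mapPt_relAct', ← mapPt_relAct', ← relAct_mul, Units.inv_mul, relAct_one] at h1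

/-! ### The automorphisms `σ_v ∈ Gal(E·K_π^{m+1}/E)` for `E ⊆ F^{nr}` -/

/-- **`σ_v ∈ Gal(E·K_π^{m+1}/E)` with `σ_v λ' = [v] λ'`** for a unit `v` and `E ⊆ F^{nr}` finite normal: the
restriction of an element of `Gal(F̄/E)` realising `v` on `λ_{m+1}` (`exists_absGal_fixing_smul_ltRoot_eq`).
[cite: deShalit1987, Ch. I §1.8] -/
def relGalOfUnit [Normal F E] (hE : E ≤ maxUnramified F) (v : 𝒪[F]ˣ) :
    (E ⊔ ltField π m : IntermediateField F (AlgebraicClosure F)) ≃ₐ[F]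
      (E ⊔ ltField π m : IntermediateField F (AlgebraicClosure F)) :=
  relRestrict hπ E m (Classical.choose (exists_absGal_fixing_smul_ltRoot_eq hπ E hE m v))

/-- `σ_v` fixes `E` pointwise. [cite: deShalit1987, Ch. I §1.8] -/
theorem relGalOfUnit_apply_inclusion [Normal F E] (hE : E ≤ maxUnramified F) (v : 𝒪[F]ˣ) (x : E) :
    relGalOfUnit hπ E m hE v (IntermediateField.inclusion le_sup_left x) = IntermediateField.inclusion le_sup_left x :=
  relRestrict_apply_inclusion hπ E m (Classical.choose_spec (exists_absGal_fixing_smul_ltRoot_eq hπ E hE m v)).1 x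

/-- ★ **`σ_v ([a]λ') = [v a]λ'`.** [cite: deShalit1987, Ch. I §1.8] -/
theorem mapPt_relGalOfUnit_relAct [Normal F E] (hE : E ≤ maxUnramified F) (v : 𝒪[F]ˣ) (a : 𝒪[F]) :
    mapPt (relGalOfUnit hπ E m hE v) (relAct hπ E m a (relGenPt hπ E m)) =
      relAct hπ E m ((v : 𝒪[F]) * a) (relGenPt hπ E m) := by
  have hσ := (Classical.choose_spec (exists_absGal_fixing_smul_ltRoot_eq hπ E hE m v)).2
  -- on `λ'` itself
  have h1 : mapPt (relGalOfUnit hπ E m hE v) (relGenPt hπ E m) = relAct hπ E m (v : 𝒪[F]) (relGenPt hπ E m) := by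
    refine pt_ext ?_
    rw [coe_mapPt, relGalOfUnit, coe_relRestrict_apply, coe_relAct_relGenPt, coe_inclPt]
    exact hσ
  rw [mul_comm, relAct_mul, mapPt_relAct', h1]

/-- `σ_v` fixes `λ'` read at level `n+1`: `σ_v(ι [a]λ_{n+1}) = ι([v a]λ_{n+1})` for `n ≤ m`.
[cite: deShalit1987, Ch. I §1.8] -/
theorem mapPt_relGalOfUnit_inclPt_relAct [Normal F E] (hE : E ≤ maxUnramified F) (v : 𝒪[F]ˣ) {n : ℕ}
    (hnm : n ≤ m) (a : 𝒪[F]) :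
    mapPt (relGalOfUnit hπ E m hE v) (inclPt (sup_le_sup_left (ltField_mono hπ hnm) E)
        (relAct hπ E n a (relGenPt hπ E n))) =
      inclPt (sup_le_sup_left (ltField_mono hπ hnm) E) (relAct hπ E n ((v : 𝒪[F]) * a) (relGenPt hπ E n)) := by
  -- `ι_{n→m}([b] λ'_n) = [b · u_n⁻¹ · π^{m-n} · u_m] λ'_m` along the coherent generator `ω_{n+1} = [π^{m-n}] ω_{m+1}`
  have hpt : ∀ b : 𝒪[F], inclPt (sup_le_sup_left (ltField_mono hπ hnm) E) (relAct hπ E n b (relGenPt hπ E n)) =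
      relAct hπ E m (b * ((cohUnit hπ n)⁻¹ : 𝒪[F]ˣ) * π ^ (m - n) * (cohUnit hπ m : 𝒪[F])) (relGenPt hπ E m) := by
    intro b
    refine pt_ext ?_
    rw [coe_inclPt, coe_relAct_relGenPt, coe_relAct_relGenPt]
    have e1 : genPt hπ n = ltAct hπ n ((cohUnit hπ n)⁻¹ : 𝒪[F]ˣ) (cohPt hπ n) := by
      rw [cohPt_eq, ← ltAct_mul, Units.inv_mul, ltAct_one]
    rw [e1, ← ltAct_mul, ← coe_inclPt (ltField_mono hπ hnm), inclPt_ltAct_of_le hπ, ← ltAct_pow_sub_cohPt hπ hnm,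
      cohPt_eq, ← ltAct_mul, ← ltAct_mul]
  rw [hpt, hpt, mapPt_relGalOfUnit_relAct]
  congr 1
  ring

/-- **Every `σ ∈ Aut(E·K_π^{m+1}/F)` acts on `λ'` through a unit**: `σ([a]λ') = [v a]λ'` for some `v ∈ 𝒪_F^×`
(namely `χ_π` of a lift of `σ` to `Γ_F`). [cite: CasselsFrohlichANT1967, Ch. VI §3.6 Prop. 6 (b)] -/
theorem exists_unit_mapPt_eq_relAct [Normal F E]
    (σ : (E ⊔ ltField π m : IntermediateField F (AlgebraicClosure F)) ≃ₐ[F]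
      (E ⊔ ltField π m : IntermediateField F (AlgebraicClosure F))) :
    ∃ v : 𝒪[F]ˣ, ∀ a : 𝒪[F], mapPt σ (relAct hπ E m a (relGenPt hπ E m)) = relAct hπ E m ((v : 𝒪[F]) * a) (relGenPt hπ E m) := by
  obtain ⟨σ', rfl⟩ := relRestrict_surjective hπ E m σ
  exact ⟨lubinTateChar hπ σ', fun a => mapPt_relRestrict_relAct hπ E m σ' a⟩

/-! ### The stabiliser of `[π^k]ω` in `Gal(E·K_π^{m+1}/E)`, parametrised by `𝓀^k` -/

variable [Normal F E] (hE : E ≤ maxUnramified F) (u : 𝒪[F]ˣ) {k : ℕ}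

/-- **The stabiliser parametrisation `e ↦ σ_e`** (`e ∈ 𝓀^k`): `σ_e = σ_{(u + π^{m+1-k}Σ digit(eᵢ)πⁱ)u⁻¹}`, so that
`σ_e ω = [u + π^{m+1-k} Σ digit(eᵢ) πⁱ]λ'` for `ω = [u]λ'`. [cite: deShalit1987, Ch. I §2.2 (2)] -/
def relStabParam (hk : k ≤ m) (e : Fin k → 𝓀[F]) :
    (E ⊔ ltField π m : IntermediateField F (AlgebraicClosure F)) ≃ₐ[F]
      (E ⊔ ltField π m : IntermediateField F (AlgebraicClosure F)) :=
  relGalOfUnit hπ E m hE ((isUnit_add_pow_mul hπ m u hk (digitSum (π := π) (residueDigit F) e)).unit * u⁻¹)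

/-- `σ_e` fixes `E` pointwise. [cite: deShalit1987, Ch. I §2.2 (2)] -/
theorem relStabParam_apply_inclusion (hk : k ≤ m) (e : Fin k → 𝓀[F]) (x : E) :
    relStabParam hπ E m hE u hk e (IntermediateField.inclusion le_sup_left x) = IntermediateField.inclusion le_sup_left x :=
  relGalOfUnit_apply_inclusion hπ E m hE _ x

/-- **`σ_e ω = [u + π^{m+1-k} Σ digit(eᵢ) πⁱ]λ'`** for `ω = [u]λ'`. [cite: deShalit1987, Ch. I §2.2 (2)] -/
theorem mapPt_relStabParam (hk : k ≤ m) (e : Fin k → 𝓀[F]) :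
    mapPt (relStabParam hπ E m hE u hk e) (relAct hπ E m (u : 𝒪[F]) (relGenPt hπ E m)) =
      relAct hπ E m ((u : 𝒪[F]) + π ^ (m + 1 - k) * digitSum (π := π) (residueDigit F) e) (relGenPt hπ E m) := by
  rw [relStabParam, mapPt_relGalOfUnit_relAct, Units.val_mul, IsUnit.unit_spec, mul_assoc, Units.inv_mul, mul_one]

/-- **`σ_e` fixes `[π^k] ω`** (`[π^k](u + π^{m+1-k}D) ≡ π^k u (mod π^{m+1})`). [cite: deShalit1987, Ch. I §2.2 (2)] -/
theorem mapPt_relStabParam_pow (hk : k ≤ m) (e : Fin k → 𝓀[F]) :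
    mapPt (relStabParam hπ E m hE u hk e) (relAct hπ E m (π ^ k) (relAct hπ E m (u : 𝒪[F]) (relGenPt hπ E m))) =
      relAct hπ E m (π ^ k) (relAct hπ E m (u : 𝒪[F]) (relGenPt hπ E m)) := by
  rw [mapPt_relAct', mapPt_relStabParam, ← relAct_mul, ← relAct_mul, relAct_relGenPt_eq_iff]
  refine ⟨digitSum (π := π) (residueDigit F) e, ?_⟩
  rw [mul_add, add_sub_cancel_left, ← mul_assoc, ← pow_add, show k + (m + 1 - k) = m + 1 by omega]

/-- **`e ↦ σ_e` is injective.** [cite: deShalit1987, Ch. I §2.2 (2)] -/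
theorem relStabParam_injective (hk : k ≤ m) : Function.Injective (relStabParam hπ E m hE u hk) := by
  intro e e' h
  have h1 := congrArg (fun σ => mapPt σ (relAct hπ E m (u : 𝒪[F]) (relGenPt hπ E m))) h
  simp only [mapPt_relStabParam] at h1
  have h2 := (relAct_relGenPt_eq_iff hπ E m).mp h1
  rw [add_sub_add_left_eq_sub, ← mul_sub] at h2
  refine digits_injective hπ m (by omega : k ≤ m + 1) ?_
  change ltAct hπ m (π ^ (m + 1 - k) * digitSum (π := π) (residueDigit F) e) (genPt hπ m) =
    ltAct hπ m (π ^ (m + 1 - k) * digitSum (π := π) (residueDigit F) e') (genPt hπ m)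
  exact ltAct_genPt_eq_of_dvd_sub hπ (by rwa [← mul_sub])

/-- ★ **`e ↦ σ_e` exhausts the stabiliser of `[π^k]ω` in `Gal(E·K_π^{m+1}/E)`**: if `σ` fixes `E` pointwise and
`σ([π^k]ω) = [π^k]ω` then `σ = σ_e` for the digit vector `e` of `(v_σ - 1)u/π^{m+1-k}` modulo `π^k`.
[cite: deShalit1987, Ch. I §2.2 (2)] -/
theorem exists_relStabParam_eq (hk : k ≤ m)
    {σ : (E ⊔ ltField π m : IntermediateField F (AlgebraicClosure F)) ≃ₐ[F]
      (E ⊔ ltField π m : IntermediateField F (AlgebraicClosure F))}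
    (hσE : ∀ x : E, σ (IntermediateField.inclusion le_sup_left x) = IntermediateField.inclusion le_sup_left x)
    (hσ : mapPt σ (relAct hπ E m (π ^ k) (relAct hπ E m (u : 𝒪[F]) (relGenPt hπ E m))) =
      relAct hπ E m (π ^ k) (relAct hπ E m (u : 𝒪[F]) (relGenPt hπ E m))) :
    ∃ e : Fin k → 𝓀[F], relStabParam hπ E m hE u hk e = σ := by
  obtain ⟨v, hv⟩ := exists_unit_mapPt_eq_relAct hπ E m σ
  -- `σ ω = [v u] λ'` and `π^{m+1} ∣ π^k v u - π^k u`
  rw [← relAct_mul, hv, relAct_relGenPt_eq_iff] at hσ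
  obtain ⟨c, hc⟩ := hσ
  have hπ0 : (π : 𝒪[F]) ≠ 0 := fun h0 => hπ.ne_zero (by rw [h0]; rfl)
  have hb : (v : 𝒪[F]) * u - u = π ^ (m + 1 - k) * c := by
    have e1 : π ^ k * ((v : 𝒪[F]) * u - u) = π ^ k * (π ^ (m + 1 - k) * c) := by
      rw [← mul_assoc (π ^ k), ← pow_add, show k + (m + 1 - k) = m + 1 by omega, ← hc]
      ring
    exact mul_left_cancel₀ (pow_ne_zero k hπ0) e1
  obtain ⟨e, he⟩ := exists_digits hπ k c
  refine ⟨e, algEquiv_eq_of_mapPt_relAct_eq hπ E m u (relStabParam_apply_inclusion hπ E m hE u hk e) hσE ?_⟩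
  rw [mapPt_relStabParam, hv]
  refine (relAct_relGenPt_eq_iff hπ E m).mpr ?_
  have e2 : (u : 𝒪[F]) + π ^ (m + 1 - k) * digitSum (π := π) (residueDigit F) e - (v : 𝒪[F]) * u =
      -(π ^ (m + 1 - k) * (c - digitSum (π := π) (residueDigit F) e)) := by
    have : (v : 𝒪[F]) * u = u + π ^ (m + 1 - k) * c := by rw [← hb]; ring
    rw [this]; ring
  rw [e2, dvd_neg]
  obtain ⟨d, hd⟩ := he
  refine ⟨d, ?_⟩
  rw [hd, ← mul_assoc, ← pow_add, show m + 1 - k + k = m + 1 by omega]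

end UnramifiedRelativeGalois

end Literature.NumberTheory.GaloisRepresentations
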